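import Summits.BirchSwinnertonDyer.Rank1Residual.GaloisImage.MultiplicativeCartanNormalizer
import Literature.NumberTheory.EllipticCurves.PAdicLFunctionMultiplicativeInterpolation

/-!
# `CartanCharSideSketch` — crux U5 `PrintX11a.UpperNonSurjFive` (stmt-BirchSwinnertonDyer-20614),
# planner-bsd-idea-17-g2-0 (bsd-idea-17 gen 2, lens = transfer).  SORRY-FREE.

Two typed-and-proved pieces of evidence for the crux (nothing here is a theorem of the route; the rung
`Theorems.X11aNonSurjMuAnHardFive` is NOT proved; BSD is not proved; no summit statement is proved by
this seat).

§1 `CmFrame` (data memo `CARTAN7-DATA.md`).  At a multiplicative prime `p ≥ 3` where `ρ̄_{E,p}`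
normalises a split Cartan subgroup `C_s(P)` and the inertia group `I_𝔏` (`𝔏 ∣ p`) maps ONTO the split
half-Cartan subgroup `P (1 0; 0 *) P⁻¹` (tree: `GaloisImage.exists_halfSplitCartan_eq_inertia_image_of_mult`,
`exists_le_normalizer_splitCartan_of_mult_of_irr_of_not_surj`), every `σ` NORMALISING `I_𝔏` — in
particular the whole decomposition group `D_𝔏` — acts through `C_s(P)` itself: an antidiagonal
element would conjugate `diag(1,u)` to `diag(u,1) ∉ P (1 0; 0 *) P⁻¹` (`u ≠ 1` exists as `p ≥ 3`).
Hence `p` is unramified and SPLIT in the Cartan field `K`, `ρ̄ ≅ Ind_K^ℚ χ̄` with `χ̄|I_𝔭 = ω`,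
`χ̄|I_𝔭̄ = 1` (PROVED: `halfCartanNormalizerInCartan`, `decompositionInSplitCartan`).

§2 `CharSide` (crux idea `charside7`, `Ideas/charside7.md`).  The character-side μ-certificate:
for THE function `L` of `(f, p, α)` with `‖α‖ = 1` in the sense of `IsMultPAdicLFunctionOf`, if `L` is
integral and ONE wild character `χ` (conductor `p^m`, even, primitive, `p`-power order) has
`‖Σ_a χ(a)[a/p^m]⁺_f‖ > p⁻¹`, then some coefficient of `L` is a `p`-adic unit (PROVED:
`unitCoeffOfLargeValue` — ultrametric `tsum` bound + discreteness of `‖·‖` on `ℚ_p`;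
`norm_sub_one_lt_one_of_pow_eq_one` — a `p`-power root of unity in `ℂ_p` is a principal unit;
`charSideCertificate`).
-/

-- the summit and its single problem are both named `BirchSwinnertonDyer` (registry layout D-0017)
set_option linter.dupNamespace false

noncomputable section

open scoped Classical NumberField MatrixGroups
open IsDedekindDomain Field Matrix NumberField
open WeierstrassCurve Literature.NumberTheory.EllipticCurves Literature.NumberTheory.GaloisRepresentations
  Literature.NumberTheory.GaloisRepresentations.Serre1972 Rat.HeightOneSpectrum
  Literature.NumberTheory.EllipticCurves.Rank1Residual
  Summit.BirchSwinnertonDyer.Rank1Residual.GaloisImage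

namespace Summit.BirchSwinnertonDyer.BirchSwinnertonDyer.Cruxes.UpperNonSurjFive.CmFrame

/-- GROUP-THEORETIC CORE.  In `GL₂(F)`, `|F| ≥ 3`: an element of the normaliser of the split Cartan
subgroup `P (* 0; 0 *) P⁻¹` which also normalises the split half-Cartan subgroup `P (1 0; 0 *) P⁻¹`
lies in the split Cartan subgroup. -/
def HalfCartanNormalizerInCartan (F : Type*) [Field F] : Prop :=
  ∀ (P g : GL (Fin 2) F), (∃ u : Fˣ, u ≠ 1) →
    g ∈ Subgroup.normalizer (splitCartan P : Set (GL (Fin 2) F)) →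
    (∀ h ∈ halfSplitCartan P, g * h * g⁻¹ ∈ halfSplitCartan P) →
    g ∈ splitCartan P

/-- The group-theoretic core holds over every field with at least three elements (the hypothesis
`∃ u : Fˣ, u ≠ 1` is part of the statement): an antidiagonal `m = P⁻¹ g P` would conjugate
`diag(1,u)` to `diag(u,1)`, whose `(0,0)` entry is `u ≠ 1`. -/
theorem halfCartanNormalizerInCartan (F : Type*) [Field F] : HalfCartanNormalizerInCartan F := by
  intro P g hF hg hgh
  rcases (mem_normalizer_splitCartan_iff hF).mp hg with hdg | had
  · exact mem_splitCartan_iff.mpr hdg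
  · exfalso
    obtain ⟨u, hu⟩ := hF
    -- `h := P · diag(1,u) · P⁻¹` lies in the split half-Cartan subgroup
    have hD : halfDiagonalHom u ∈ halfDiagonalSubgroup F := by
      rw [← range_halfDiagonalHom]; exact ⟨u, rfl⟩
    have hh : (MulAut.conj P).toMonoidHom (halfDiagonalHom u) ∈ halfSplitCartan P :=
      ⟨halfDiagonalHom u, hD, rfl⟩
    have hN := hgh _ hh
    rw [mem_halfSplitCartan_iff] at hN
    obtain ⟨hNdg, hN00⟩ := hN
    set m : GL (Fin 2) F := P⁻¹ * g * P with hm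
    have hconj : P⁻¹ * (g * (MulAut.conj P).toMonoidHom (halfDiagonalHom u) * g⁻¹) * P =
        m * halfDiagonalHom u * m⁻¹ := by
      rw [MulEquiv.coe_toMonoidHom, MulAut.conj_apply, hm]; group
    rw [hconj] at hNdg hN00
    -- the matrix identity `(m D m⁻¹) m = m D`, read at entry `(0,1)`
    have key : ((m * halfDiagonalHom u * m⁻¹ : GL (Fin 2) F) : Matrix (Fin 2) (Fin 2) F) *
        (m : Matrix (Fin 2) (Fin 2) F) = (m : Matrix (Fin 2) (Fin 2) F) * diagonal ![1, (u : F)] := by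
      rw [← coe_halfDiagonalHom, ← Units.val_mul, ← Units.val_mul]
      congr 1
      group
    have h01 := congrFun (congrFun key 0) 1
    simp only [Matrix.mul_apply, Fin.sum_univ_two, hN00, hNdg.1, had.1, had.2, one_mul,
      add_zero, zero_add, mul_zero, diagonal_apply_eq, Matrix.cons_val_one,
      diagonal_apply_ne _ (show (0 : Fin 2) ≠ 1 by decide)] at h01
    -- `m 0 1 ≠ 0` since `m` is antidiagonal and invertible
    have hm01 : (m : Matrix (Fin 2) (Fin 2) F) 0 1 ≠ 0 := by
      intro h0
      apply GL2.det_ne_zero m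
      rw [Matrix.det_fin_two, had.1, had.2, h0]; ring
    have hu1 : (u : F) = 1 := by
      have h' : (m : Matrix (Fin 2) (Fin 2) F) 0 1 * 1 = (m : Matrix (Fin 2) (Fin 2) F) 0 1 * u := by
        rw [mul_one]; exact h01
      exact (mul_left_cancel₀ hm01 h').symm
    exact hu (Units.ext hu1)

/-- FIRST LEMMA (Galois form, frame `Φ`).  If the mod-`p` image normalises `C_s(P)` and a subgroup
`I ≤ Γ_ℚ` (the inertia group at `𝔏 ∣ p`) maps onto the split half-Cartan subgroup of `P`, then every
`σ` in the normaliser of `I` (so every element of the decomposition group at `𝔏`) maps into `C_s(P)`. -/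
def DecompositionInSplitCartan : Prop :=
  ∀ (W : WeierstrassCurve ℚ) [W.IsElliptic] (p : ℕ) [Fact p.Prime]
    (Φ : Multiplicative (AddAut (geomTorsion W p)) ≃* GL (Fin 2) (ZMod p)),
    3 ≤ p →
    ∀ (I : Subgroup (absoluteGaloisGroup ℚ)) (P : GL (Fin 2) (ZMod p)),
      (I.map (galoisRepTorsion W p)).map Φ.toMonoidHom = halfSplitCartan P →
      (galoisRepTorsion W p).range.map Φ.toMonoidHom ≤
          Subgroup.normalizer (splitCartan P : Set (GL (Fin 2) (ZMod p))) →
      ∀ σ ∈ Subgroup.normalizer (I : Set (absoluteGaloisGroup ℚ)),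
        Φ (galoisRepTorsion W p σ) ∈ splitCartan P

/-- The Galois form follows formally from the group-theoretic core. -/
theorem decompositionInSplitCartan_of_core
    (hcore : ∀ p : ℕ, [Fact p.Prime] → HalfCartanNormalizerInCartan (ZMod p)) :
    DecompositionInSplitCartan := by
  intro W _ p _ Φ hp I P hI hN σ hσ
  have hF : ∃ u : (ZMod p)ˣ, u ≠ 1 := exists_units_ne_one (p := p) (by omega)
  refine hcore p P (Φ (galoisRepTorsion W p σ)) hF (hN ⟨galoisRepTorsion W p σ, ⟨σ, rfl⟩, rfl⟩) ?_
  intro h hh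
  -- `h = Φ (ρ̄ τ)` with `τ ∈ I`
  rw [← hI] at hh
  obtain ⟨x, ⟨τ, hτ, rfl⟩, rfl⟩ := hh
  rw [← hI]
  refine ⟨galoisRepTorsion W p (σ * τ * σ⁻¹), ⟨σ * τ * σ⁻¹, ?_, rfl⟩, ?_⟩
  · exact (Subgroup.mem_normalizer_iff.mp hσ τ).mp hτ
  · simp only [MulEquiv.coe_toMonoidHom, map_mul, map_inv]

/-- FIRST LEMMA, unconditionally. -/
theorem decompositionInSplitCartan : DecompositionInSplitCartan :=
  decompositionInSplitCartan_of_core fun p _ => halfCartanNormalizerInCartan (ZMod p)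

end Summit.BirchSwinnertonDyer.BirchSwinnertonDyer.Cruxes.UpperNonSurjFive.CmFrame

/-! ## Crux idea `charside7` — character-side certificate (first lemma, typed only)

The ω⁰-branch `L ∈ ℤ_p⟦T⟧` of a pair is read on the CHARACTER side: at `x = χ(γ) - 1` (`χ` wild of
conductor `p^m`, `‖x‖ < 1`) the value is `α^{-m} Σ_a χ(a)[a/p^m]⁺ = ±(twisted central value)`, and a
value of norm `> p⁻¹` forces a unit coefficient (ultrametric inequality; `ℚ_p`-norms are powers of `p`).
This is the elementary half of the per-pair engine; the other half is the interpolation clause of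
`Literature.NumberTheory.EllipticCurves.IsMultPAdicLFunctionOf` and Wiersema–Wuthrich integrality. -/
namespace Summit.BirchSwinnertonDyer.BirchSwinnertonDyer.Cruxes.UpperNonSurjFive.CharSide

/-- FIRST LEMMA of `charside7`: a value of norm `> p⁻¹` at a point of the open unit disc forces a unit
coefficient of an integral power series. -/
def UnitCoeffOfLargeValue : Prop :=
  ∀ (p : ℕ) [Fact p.Prime] (L : PowerSeries ℚ_[p]) (x s : ℂ_[p]),
    (∀ n, ‖PowerSeries.coeff n L‖ ≤ 1) → ‖x‖ < 1 →
    HasSum (fun k : ℕ ↦ algebraMap ℚ_[p] ℂ_[p] (PowerSeries.coeff k L) * x ^ k) s →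
    (p : ℝ)⁻¹ < ‖s‖ → ∃ n, ‖PowerSeries.coeff n L‖ = 1

/-- The certificate plugged into the multiplicative interpolation package of the tree: for THE
function `L` of `(f, p, α)` (`α = a_p = ±1`), one wild character `χ` of conductor `p^m` with
`‖Σ_a χ(a)[a/p^m]⁺_f‖ > p⁻¹` gives a unit coefficient, provided `L` is integral. -/
def CharSideCertificate : Prop :=
  ∀ {N : ℕ} (f : CuspForm (CongruenceSubgroup.Gamma0 N) 2) (p : ℕ) [Fact p.Prime] (α : ℚ_[p])
    (L : PowerSeries ℚ_[p]), ‖α‖ = 1 →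
    Literature.NumberTheory.EllipticCurves.IsMultPAdicLFunctionOf f p α L →
    (∀ n, ‖PowerSeries.coeff n L‖ ≤ 1) →
    (∃ (m : ℕ), 0 < m ∧ ∃ χ : DirichletCharacter ℂ_[p] (p ^ m), χ.IsPrimitive ∧ χ.Even ∧
      (∃ j : ℕ, orderOf χ = p ^ j) ∧
      (p : ℝ)⁻¹ < ‖Literature.NumberTheory.EllipticCurves.ratTwistedSymbolSum f χ‖) →
    ∃ n, ‖PowerSeries.coeff n L‖ = 1

/-- A `p`-power root of unity in `ℂ_p` is a principal unit: `ζ ^ (p ^ j) = 1 → ‖ζ - 1‖ < 1`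
(binomial expansion of `((ζ - 1) + 1)^(p^j)`; `p` divides the inner binomial coefficients). -/
theorem norm_sub_one_lt_one_of_pow_eq_one (p : ℕ) [Fact p.Prime] (j : ℕ) (ζ : ℂ_[p])
    (hζ : ζ ^ (p ^ j) = 1) : ‖ζ - 1‖ < 1 := by
  have hp : p.Prime := Fact.out
  have hn0 : p ^ j ≠ 0 := pow_ne_zero _ hp.ne_zero
  obtain ⟨n', hn'⟩ : ∃ n', p ^ j = n' + 1 := Nat.exists_eq_succ_of_ne_zero hn0
  set x : ℂ_[p] := ζ - 1 with hx
  have hζ1 : ‖ζ‖ = 1 := by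
    have h := congrArg norm hζ
    rw [norm_pow, norm_one] at h
    exact (pow_eq_one_iff_of_nonneg (norm_nonneg ζ) hn0).mp h
  have hx1 : ‖x‖ ≤ 1 := by
    have h := IsUltrametricDist.norm_add_le_max ζ (-1 : ℂ_[p])
    rw [← sub_eq_add_neg, norm_neg, norm_one, hζ1, max_self] at h
    exact h
  have hexp : x ^ (p ^ j) =
      -∑ k ∈ Finset.range n', x ^ (k + 1) * ((p ^ j).choose (k + 1) : ℂ_[p]) := by
    have h1 : (x + 1) ^ (p ^ j) = 1 := by rw [hx, sub_add_cancel, hζ]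
    rw [add_pow, Finset.sum_range_succ, hn', Finset.sum_range_succ', ← hn'] at h1
    simp only [one_pow, mul_one, pow_zero, Nat.choose_zero_right, Nat.cast_one, Nat.choose_self] at h1
    linear_combination h1
  have hpC : ‖(p : ℂ_[p])‖ = (p : ℝ)⁻¹ := by
    rw [← map_natCast (algebraMap ℚ_[p] ℂ_[p]) p, norm_algebraMap', Padic.norm_p]
  have hterm : ∀ k ∈ Finset.range n',
      ‖x ^ (k + 1) * ((p ^ j).choose (k + 1) : ℂ_[p])‖ ≤ (p : ℝ)⁻¹ := by
    intro k hk
    have hk' : k + 1 ≠ p ^ j := by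
      have := Finset.mem_range.mp hk
      omega
    obtain ⟨d, hd⟩ := hp.dvd_choose_pow (Nat.succ_ne_zero k) hk'
    have hdC : ‖(d : ℂ_[p])‖ ≤ 1 := by
      rw [← map_natCast (algebraMap ℚ_[p] ℂ_[p]) d, norm_algebraMap']
      have h := Padic.norm_int_le_one (p := p) (d : ℤ)
      rwa [Int.cast_natCast] at h
    rw [norm_mul, norm_pow, hd, Nat.cast_mul, norm_mul, hpC]
    calc ‖x‖ ^ (k + 1) * ((p : ℝ)⁻¹ * ‖(d : ℂ_[p])‖) ≤ 1 * ((p : ℝ)⁻¹ * 1) :=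
          mul_le_mul (pow_le_one₀ (norm_nonneg _) hx1)
            (mul_le_mul_of_nonneg_left hdC (by positivity)) (by positivity) zero_le_one
      _ = (p : ℝ)⁻¹ := by ring
  have hxn : ‖x‖ ^ (p ^ j) ≤ (p : ℝ)⁻¹ := by
    rw [← norm_pow, hexp, norm_neg]
    exact IsUltrametricDist.norm_sum_le_of_forall_le_of_nonneg (by positivity) hterm
  have hp1 : (p : ℝ)⁻¹ < 1 := inv_lt_one_of_one_lt₀ (by exact_mod_cast hp.one_lt)
  by_contra hcon
  have h1 : (1 : ℝ) ≤ ‖x‖ ^ (p ^ j) := one_le_pow₀ (not_lt.mp hcon)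
  linarith

/-- `UnitCoeffOfLargeValue` HOLDS (ultrametric bound for `tsum` + discreteness of `‖·‖` on `ℚ_p`). -/
theorem unitCoeffOfLargeValue : UnitCoeffOfLargeValue := by
  intro p _ L x s hint hx hsum hs
  have hp : p.Prime := Fact.out
  by_contra hne
  push Not at hne
  have hle : ∀ n, ‖PowerSeries.coeff n L‖ ≤ (p : ℝ)⁻¹ := by
    intro n
    have hlt : ‖PowerSeries.coeff n L‖ < 1 := lt_of_le_of_ne (hint n) (hne n)
    have h := (Padic.norm_lt_pow_iff_norm_le_pow_sub_one (PowerSeries.coeff n L) 0).mp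
      (by simpa using hlt)
    simpa using h
  have hterm : ∀ k, ‖algebraMap ℚ_[p] ℂ_[p] (PowerSeries.coeff k L) * x ^ k‖ ≤ (p : ℝ)⁻¹ := by
    intro k
    rw [norm_mul, norm_algebraMap', norm_pow]
    calc ‖PowerSeries.coeff k L‖ * ‖x‖ ^ k ≤ (p : ℝ)⁻¹ * 1 :=
          mul_le_mul (hle k) (pow_le_one₀ (norm_nonneg _) hx.le) (by positivity) (by positivity)
      _ = (p : ℝ)⁻¹ := mul_one _
  have hs' : ‖s‖ ≤ (p : ℝ)⁻¹ := by
    rw [← hsum.tsum_eq]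
    exact IsUltrametricDist.norm_tsum_le_of_forall_le_of_nonneg (by positivity) hterm
  exact absurd hs (not_lt.mpr hs')

/-- `CharSideCertificate` is `UnitCoeffOfLargeValue` composed with the interpolation clause. -/
theorem charSideCertificate_of_unitCoeff (h : UnitCoeffOfLargeValue) : CharSideCertificate := by
  intro N f p _ α L hα hL hint ⟨m, hm, χ, hprim, heven, hord, hval⟩
  have hp : p.Prime := Fact.out
  obtain ⟨-, -, hinterp⟩ := hL
  have hsum := hinterp m hm χ hprim heven hord
  refine h p L (χ (Literature.NumberTheory.EllipticCurves.cyclotomicGenerator p : ZMod (p ^ m)) - 1) _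
    hint ?_ hsum ?_
  · -- `χ(γ)` is a `p`-power root of unity (`γ = 1 + p^{e₀}` is a unit mod `p^m`, `orderOf χ = p^j`)
    obtain ⟨j, hj⟩ := hord
    apply norm_sub_one_lt_one_of_pow_eq_one p j
    have he : Literature.NumberTheory.EllipticCurves.cyclotomicExponent p ≠ 0 := by
      unfold Literature.NumberTheory.EllipticCurves.cyclotomicExponent
      split_ifs <;> omega
    have hγ : IsUnit ((Literature.NumberTheory.EllipticCurves.cyclotomicGenerator p : ℕ) :
        ZMod (p ^ m)) := by
      rw [ZMod.isUnit_natCast_iff_not_dvd_pow hp hm,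
        Literature.NumberTheory.EllipticCurves.cyclotomicGenerator,
        Nat.dvd_add_left (dvd_pow_self p he)]
      exact fun h => hp.one_lt.ne' (Nat.dvd_one.mp h)
    rw [← MulChar.pow_apply' χ (pow_ne_zero j hp.ne_zero), ← hj, pow_orderOf_eq_one,
      MulChar.one_apply hγ]
  · rwa [norm_mul, map_pow, map_inv₀, norm_pow, norm_inv, norm_algebraMap', hα, inv_one, one_pow, one_mul]

/-- The character-side certificate, unconditionally (sorry-free). -/
theorem charSideCertificate : CharSideCertificate :=
  charSideCertificate_of_unitCoeff unitCoeffOfLargeValue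

end Summit.BirchSwinnertonDyer.BirchSwinnertonDyer.Cruxes.UpperNonSurjFive.CharSide

end
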